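import Summits.CriticalPhenomena.PercolationContinuityZ3.Theorems.NearLinearTwoClusterDecay.Negative.LoadBearing

/-!
# `NearLinearTwoClusterDecay` (stmt-CriticalPhenomena-5785) — negative side II: rays, non-nullity,
# no decay at bounded ADDITIVE aspect

From the standing disprover's `Cruxes/NearLinearTwoClusterDecay/Disproof.lean` (cdisprove v6, §(b)/(c)),
landed by the line lead (seat c2).  Two straight open rays `(n,0,0) → (n+k,0,0)` and
`(-n,0,0) → (-(n+k),0,0)`, the positive one wrapped in closed edges, realise the two-cluster event of
`(Λ(n), Λ(n+k))` with probability `≥ p_c^{2k} (1-p_c)^{6(k+1)}`, uniformly in `n ≥ 1`: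

* `real_twoClusterEvt_pos`, `not_eventually_real_eq_zero` — the event is NON-NULL at every scale
  `1 ≤ n ≤ m` (no emptiness/nullity proof of the crux; decay no faster than `exp(-O(n^{7/6}))`);
* `not_tendsto_additive_aspect` — **any proof must use `m - n → ∞`**: for every fixed `k` the
  two-cluster probability of `(Λ(n), Λ(n+k))` does not tend to `0` (print truth is stronger: no decay at
  bounded MULTIPLICATIVE aspect along a scale sequence, van den Berg–van Engelenburg, arXiv:2009.13337 Prop. 2).
-/

namespace Summit.CriticalPhenomena.PercolationContinuityZ3.Theorems.NearLinearTwoClusterDecay.Negative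

open MeasureTheory Filter Topology
open Literature.Probability.LatticeModels Literature.Probability.Percolation
open Summit.CriticalPhenomena.PercolationContinuityZ3.Theses

noncomputable section

/-- The axis site `(j, 0, 0)`. [folklore] -/
def ax (j : ℤ) : Site 3 := Pi.single 0 j

/-- `j ↦ (j,0,0)` is injective. [folklore] -/
theorem ax_injective : Function.Injective ax := fun i j h => by
  simpa [ax] using congr_fun h 0

/-- `(j,0,0) ∈ Λ(m)` iff `|j| ≤ m` (the `if` direction). [folklore] -/
theorem ax_mem_box {j : ℤ} {m : ℕ} (h1 : -(m : ℤ) ≤ j) (h2 : j ≤ m) : ax j ∈ box 3 m := by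
  rw [mem_box]; intro i
  by_cases hi : i = 0
  · subst hi; simp only [ax, Pi.single_eq_same]; exact ⟨h1, h2⟩
  · simp only [ax, Pi.single_eq_of_ne hi]; omega

/-- `(j,0,0) ∈ Λ(m)` iff `|j| ≤ m`. [folklore] -/
theorem ax_mem_box_iff {j : ℤ} {m : ℕ} : ax j ∈ box 3 m ↔ -(m : ℤ) ≤ j ∧ j ≤ m := by
  refine ⟨fun h => ?_, fun h => ax_mem_box h.1 h.2⟩
  rw [mem_box] at h
  simpa [ax] using h 0

/-- `(j+1,0,0) = (j,0,0) + e₀`. [folklore] -/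
theorem ax_succ (j : ℤ) : ax (j + 1) = ax j + Pi.single 0 1 := by
  simp only [ax]
  exact Pi.single_add (f := fun _ : Fin 3 => ℤ) 0 j 1

/-- Consecutive axis sites span a lattice edge. [folklore] -/
theorem ax_edge_mem (j : ℤ) : s(ax j, ax (j + 1)) ∈ (zdGraph 3).edgeSet := by
  rw [SimpleGraph.mem_edgeSet, zdGraph_adj_iff]; exact ⟨0, Or.inl (ax_succ j)⟩

/-- `(m,0,0) ∈ ∂ⁱⁿΛ(m)`. [folklore] -/
theorem ax_mem_innerBoundary (m : ℕ) : ax m ∈ innerBoundary (zdGraph 3) (box 3 m) := by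
  rw [mem_innerBoundary_iff]
  refine ⟨ax_mem_box (by omega) le_rfl, ax (m + 1), ?_, (SimpleGraph.mem_edgeSet _).1 (ax_edge_mem m)⟩
  rw [ax_mem_box_iff]; omega

/-- `(-m,0,0) ∈ ∂ⁱⁿΛ(m)`. [folklore] -/
theorem ax_neg_mem_innerBoundary (m : ℕ) : ax (-(m : ℤ)) ∈ innerBoundary (zdGraph 3) (box 3 m) := by
  rw [mem_innerBoundary_iff]
  refine ⟨ax_mem_box le_rfl (by omega), ax (-(m : ℤ) - 1), ?_, ?_⟩
  · rw [ax_mem_box_iff]; omega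
  · have h := ((SimpleGraph.mem_edgeSet _).1 (ax_edge_mem (-(m : ℤ) - 1))).symm
    rwa [sub_add_cancel] at h

/-- The open edges of the construction: the two rays. [folklore] -/
def rayEdges (n k : ℕ) : Finset (Sym2 (Site 3)) :=
  (Finset.Ico (n : ℤ) (n + k) ∪ Finset.Ico (-((n : ℤ) + k)) (-(n : ℤ))).image
    fun j => s(ax j, ax (j + 1))

/-- The closed edges of the construction: every lattice edge at the positive ray other than the
ray's own edges. [folklore] -/
def shellEdges (n k : ℕ) : Finset (Sym2 (Site 3)) :=
  ((Finset.Icc (n : ℤ) (n + k)).biUnion fun j => (zdGraph 3).incidenceFinset (ax j)) \ rayEdges n k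

/-- Membership in `rayEdges`. [folklore] -/
theorem mem_rayEdges {n k : ℕ} {e : Sym2 (Site 3)} :
    e ∈ rayEdges n k ↔ ∃ j : ℤ, (((n : ℤ) ≤ j ∧ j < n + k) ∨ (-((n : ℤ) + k) ≤ j ∧ j < -(n : ℤ))) ∧
      s(ax j, ax (j + 1)) = e := by
  simp [rayEdges]

/-- The ray edges are lattice edges. [folklore] -/
theorem rayEdges_subset_edgeSet (n k : ℕ) : (↑(rayEdges n k) : Set (Sym2 (Site 3))) ⊆ (zdGraph 3).edgeSet := by
  intro e he
  obtain ⟨j, -, rfl⟩ := mem_rayEdges.1 (Finset.mem_coe.1 he)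
  exact ax_edge_mem j

/-- At most `2k` ray edges. [folklore] -/
theorem card_rayEdges_le (n k : ℕ) : (rayEdges n k).card ≤ 2 * k := by
  refine (Finset.card_image_le).trans ((Finset.card_union_le _ _).trans ?_)
  rw [Int.card_Ico, Int.card_Ico]
  omega

/-- At most `6(k+1)` shell edges. [folklore] -/
theorem card_shellEdges_le (n k : ℕ) : (shellEdges n k).card ≤ 6 * (k + 1) := by
  classical
  refine (Finset.card_le_card Finset.sdiff_subset).trans (Finset.card_biUnion_le.trans ?_)
  simp only [card_incidenceFinset_zdGraph_three, Finset.sum_const, smul_eq_mul, Int.card_Icc]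
  omega

/-- The event "rays open, shell closed" is determined by finitely many edges (for independence). [folklore] -/
theorem determinedBy_setOf_finsetSubset (F : Finset (Sym2 (Site 3))) :
    DeterminedBy {ω : BondConfig (Site 3) | (↑F : Set (Sym2 (Site 3))) ⊆ ω} ↑F := by
  rw [determinedBy_iff]
  intro ω ω' h
  simp only [Set.mem_setOf_eq]
  constructor
  · intro hω e he
    exact ((Set.ext_iff.1 h e).1 ⟨hω he, he⟩).1
  · intro hω' e he
    exact ((Set.ext_iff.1 h e).2 ⟨hω' he, he⟩).1

/-- Along the positive ray. [folklore] -/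
theorem pathIn_posRay {ω : BondConfig (Site 3)} {n k : ℕ}
    (hO : (↑(rayEdges n k) : Set (Sym2 (Site 3))) ⊆ ω) :
    ∀ i : ℕ, i ≤ k → PathIn (openGraph ω) ↑(box 3 (n + k)) (ax n) (ax ((n : ℤ) + i)) := by
  intro i
  induction i with
  | zero =>
    intro _
    simpa using PathIn.refl (G := openGraph ω) (Finset.mem_coe.2 (ax_mem_box (j := (n : ℤ)) (m := n + k) (by omega) (by omega)))
  | succ i ih =>
    intro hi
    have hprev := ih (Nat.le_of_succ_le hi)
    refine hprev.tail ?_ (Finset.mem_coe.2 (ax_mem_box (by omega) (by omega)))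
    rw [openGraph_adj]
    refine ⟨hO (Finset.mem_coe.2 (mem_rayEdges.2 ⟨(n : ℤ) + i, Or.inl ⟨by omega, by omega⟩, ?_⟩)),
      ax_injective.ne (by omega)⟩
    push_cast; ring_nf

/-- Along the negative ray. [folklore] -/
theorem pathIn_negRay {ω : BondConfig (Site 3)} {n k : ℕ}
    (hO : (↑(rayEdges n k) : Set (Sym2 (Site 3))) ⊆ ω) :
    ∀ i : ℕ, i ≤ k → PathIn (openGraph ω) ↑(box 3 (n + k)) (ax (-(n : ℤ))) (ax (-(n : ℤ) - i)) := by
  intro i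
  induction i with
  | zero =>
    intro _
    simpa using PathIn.refl (G := openGraph ω) (Finset.mem_coe.2 (ax_mem_box (j := -(n : ℤ)) (m := n + k) (by omega) (by omega)))
  | succ i ih =>
    intro hi
    have hprev := ih (Nat.le_of_succ_le hi)
    refine hprev.tail ?_ (Finset.mem_coe.2 (ax_mem_box (by omega) (by omega)))
    rw [openGraph_adj]
    refine ⟨?_, ax_injective.ne (by omega)⟩
    have hmem : s(ax (-(n : ℤ) - i - 1), ax (-(n : ℤ) - i - 1 + 1)) ∈ rayEdges n k :=
      mem_rayEdges.2 ⟨-(n : ℤ) - i - 1, Or.inr ⟨by omega, by omega⟩, rfl⟩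
    have := hO (Finset.mem_coe.2 hmem)
    rw [sub_add_cancel, Sym2.eq_swap] at this
    convert this using 3
    push_cast; ring

/-- The positive ray is a whole cluster: nothing escapes it when the shell is closed. [folklore] -/
theorem not_openConnIn_ax_neg {ω : BondConfig (Site 3)} (hω : ω ⊆ (zdGraph 3).edgeSet) {n k : ℕ}
    (hn : 1 ≤ n) (hC : ∀ e ∈ shellEdges n k, e ∉ ω) (S : Set (Site 3)) :
    ω ∉ openConnIn S (ax n) (ax (-(n : ℤ))) := by
  classical
  intro h
  rw [DCT16.mem_openConnIn_iff_pathIn] at h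
  have key := DCT16.pathIn_induction (fun v => ∃ j : ℤ, (n : ℤ) ≤ j ∧ j ≤ n + k ∧ v = ax j) h
    ⟨n, le_rfl, by omega, rfl⟩ ?_
  · obtain ⟨j, hj1, -, hj⟩ := key
    have := ax_injective hj
    omega
  · rintro a b - - ⟨j, hj1, hj2, rfl⟩ hadj
    rw [openGraph_adj] at hadj
    have hlat : (zdGraph 3).Adj (ax j) b := (SimpleGraph.mem_edgeSet _).1 (hω hadj.1)
    have hinc : s(ax j, b) ∈ (zdGraph 3).incidenceFinset (ax j) := by
      rw [SimpleGraph.mem_incidenceFinset, SimpleGraph.mk'_mem_incidenceSet_left_iff]; exact hlat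
    have hbi : s(ax j, b) ∈ (Finset.Icc (n : ℤ) (n + k)).biUnion
        fun j => (zdGraph 3).incidenceFinset (ax j) :=
      Finset.mem_biUnion.2 ⟨j, Finset.mem_Icc.2 ⟨hj1, hj2⟩, hinc⟩
    by_cases hray : s(ax j, b) ∈ rayEdges n k
    · obtain ⟨i, hi, hie⟩ := mem_rayEdges.1 hray
      rcases Sym2.eq_iff.1 hie with ⟨h1, h2⟩ | ⟨h1, h2⟩
      · have := ax_injective h1
        subst this
        exact ⟨i + 1, by omega, by omega, h2.symm⟩
      · have := ax_injective h2
        exact ⟨i, by omega, by omega, h1.symm⟩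
    · exact (hC _ (Finset.mem_sdiff.2 ⟨hbi, hray⟩) hadj.1).elim

/-- On "rays open, shell closed" (and `ω ⊆ E(ℤ³)`) the two-cluster event of `(Λ(n), Λ(n+k))`
occurs, `n ≥ 1`. [folklore] -/
theorem twoClusterEvt_of_rays {ω : BondConfig (Site 3)} (hω : ω ⊆ (zdGraph 3).edgeSet) {n k : ℕ}
    (hn : 1 ≤ n) (hO : (↑(rayEdges n k) : Set (Sym2 (Site 3))) ⊆ ω)
    (hC : ∀ e ∈ shellEdges n k, e ∉ ω) : ω ∈ twoClusterEvt n (n + k) := by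
  refine ⟨ax n, ax_mem_box (by omega) le_rfl, ax (-(n : ℤ)), ax_mem_box le_rfl (by omega),
    ax ((n : ℤ) + k), ?_, ax (-(n : ℤ) - k), ?_, ?_, ?_, not_openConnIn_ax_neg hω hn hC _⟩
  · exact_mod_cast ax_mem_innerBoundary (n + k)
  · have := ax_neg_mem_innerBoundary (n + k)
    convert this using 2; push_cast; ring
  · exact DCT16.mem_openConnIn_iff_pathIn.2 (pathIn_posRay hO k le_rfl)
  · exact DCT16.mem_openConnIn_iff_pathIn.2 (pathIn_negRay hO k le_rfl)

/-- **Quantitative non-nullness, uniform in `n`**: for `n ≥ 1` and every `k`,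
`P_{p_c}(two-cluster event of (Λ(n), Λ(n+k))) ≥ p_c^{2k} (1 - p_c)^{6(k+1)}`. [folklore] -/
theorem real_twoClusterEvt_add_ge {n : ℕ} (hn : 1 ≤ n) (k : ℕ) :
    (criticalProbI 3 : ℝ) ^ (2 * k) * (1 - (criticalProbI 3 : ℝ)) ^ (6 * (k + 1)) ≤
      critBond.real (twoClusterEvt n (n + k)) := by
  classical
  set p : unitInterval := criticalProbI 3 with hp
  have hp0 : 0 ≤ (p : ℝ) := p.2.1
  have hp1 : (p : ℝ) ≤ 1 := p.2.2
  have hdisj : Disjoint (↑(rayEdges n k) : Set (Sym2 (Site 3))) ↑(shellEdges n k) := by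
    rw [Finset.disjoint_coe]; exact Finset.disjoint_sdiff
  have hindep := bondPercolation_real_inter_of_disjoint (zdGraph 3) p hdisj
    (determinedBy_setOf_finsetSubset (rayEdges n k)) (determinedBy_forall_notMem (shellEdges n k))
    ((determinedBy_setOf_finsetSubset (rayEdges n k)).measurableSet_of_finset)
    (measurableSet_forall_notMem (shellEdges n k))
  have h1 : critBond.real {ω | (↑(rayEdges n k) : Set (Sym2 (Site 3))) ⊆ ω} = (p : ℝ) ^ (rayEdges n k).card :=
    bondPercolation_real_setOf_subset _ _ _ (rayEdges_subset_edgeSet n k)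
  have h2 : (1 - (p : ℝ)) ^ (shellEdges n k).card ≤ critBond.real {ω | ∀ e ∈ shellEdges n k, e ∉ ω} :=
    le_bondPercolation_real_forall_notMem _ _ _
  calc (p : ℝ) ^ (2 * k) * (1 - (p : ℝ)) ^ (6 * (k + 1))
      ≤ (p : ℝ) ^ (rayEdges n k).card * (1 - (p : ℝ)) ^ (shellEdges n k).card :=
        mul_le_mul (pow_le_pow_of_le_one hp0 hp1 (card_rayEdges_le n k))
          (pow_le_pow_of_le_one (sub_nonneg.2 hp1) (sub_le_self _ hp0) (card_shellEdges_le n k))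
          (by positivity) (by positivity)
    _ ≤ critBond.real {ω | (↑(rayEdges n k) : Set (Sym2 (Site 3))) ⊆ ω} *
          critBond.real {ω | ∀ e ∈ shellEdges n k, e ∉ ω} := by
        rw [h1]; exact mul_le_mul_of_nonneg_left h2 (by positivity)
    _ = critBond.real ({ω | (↑(rayEdges n k) : Set (Sym2 (Site 3))) ⊆ ω} ∩
          {ω | ∀ e ∈ shellEdges n k, e ∉ ω}) := hindep.symm
    _ ≤ critBond.real (twoClusterEvt n (n + k)) :=
        DCT16.real_mono_of_forall_subset_edgeSet _ _ fun ω hω hmem =>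
          twoClusterEvt_of_rays hω hn hmem.1 hmem.2

/-- **(c) The event is non-null at every scale**: `P_{p_c}(two-cluster event of (Λ(n), Λ(m))) > 0`
whenever `1 ≤ n ≤ m`; the crux is not closable by showing the event empty or null. [folklore] -/
theorem real_twoClusterEvt_pos {n m : ℕ} (hn : 1 ≤ n) (hnm : n ≤ m) :
    0 < critBond.real (twoClusterEvt n m) := by
  obtain ⟨k, rfl⟩ := Nat.exists_eq_add_of_le hnm
  refine lt_of_lt_of_le ?_ (real_twoClusterEvt_add_ge hn k)
  have h0 := (show (0 : ℝ) < ((criticalProbI 3 : unitInterval) : ℝ) by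
      rw [coe_criticalProbI]; exact (Grimmett1999_criticalProb_pos_lt_one_holds 3 (by norm_num)).1)
  have h1 := (show ((criticalProbI 3 : unitInterval) : ℝ) < 1 by
      rw [coe_criticalProbI]; exact (Grimmett1999_criticalProb_pos_lt_one_holds 3 (by norm_num)).2)
  positivity

/-- The natural strengthening "the crux event is eventually NULL" is false. [folklore] -/
theorem not_eventually_real_eq_zero :
    ¬ ∀ᶠ n : ℕ in atTop, critBond.real (twoClusterEvt n ⌈(n : ℝ) ^ ((7 : ℝ) / 6)⌉₊) = 0 := by
  intro h
  obtain ⟨n, h0, hn⟩ := (h.and (eventually_ge_atTop 1)).exists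
  have hn' : (1 : ℝ) ≤ n := by exact_mod_cast hn
  have hpow : (n : ℝ) ≤ (n : ℝ) ^ ((7 : ℝ) / 6) := by
    calc (n : ℝ) = (n : ℝ) ^ (1 : ℝ) := (Real.rpow_one _).symm
      _ ≤ (n : ℝ) ^ ((7 : ℝ) / 6) := Real.rpow_le_rpow_of_exponent_le hn' (by norm_num)
  have hle : n ≤ ⌈(n : ℝ) ^ ((7 : ℝ) / 6)⌉₊ := by
    calc n = ⌈((n : ℕ) : ℝ)⌉₊ := (Nat.ceil_natCast n).symm
      _ ≤ ⌈(n : ℝ) ^ ((7 : ℝ) / 6)⌉₊ := Nat.ceil_mono hpow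
  exact (real_twoClusterEvt_pos hn hle).ne' h0

/-- **(b) Tightness towards the boundary: no decay at any bounded additive aspect.** For every
fixed `k`, the two-cluster probability of `(Λ(n), Λ(n+k))` stays `≥ p_c^{2k}(1-p_c)^{6(k+1)} > 0`;
any proof of the crux must use `m - n → ∞` (print: even `m/n → ∞` is needed, vdBvE 2022 Prop. 2). [folklore] -/
theorem not_tendsto_additive_aspect (k : ℕ) :
    ¬ Tendsto (fun n : ℕ => critBond.real (twoClusterEvt n (n + k))) atTop (𝓝 0) := by
  intro h
  have hc : 0 < (criticalProbI 3 : ℝ) ^ (2 * k) * (1 - (criticalProbI 3 : ℝ)) ^ (6 * (k + 1)) := by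
    have h0 := (show (0 : ℝ) < ((criticalProbI 3 : unitInterval) : ℝ) by
      rw [coe_criticalProbI]; exact (Grimmett1999_criticalProb_pos_lt_one_holds 3 (by norm_num)).1)
    have h1 := (show ((criticalProbI 3 : unitInterval) : ℝ) < 1 by
      rw [coe_criticalProbI]; exact (Grimmett1999_criticalProb_pos_lt_one_holds 3 (by norm_num)).2)
    positivity
  obtain ⟨n, hlt, hn⟩ := ((h.eventually (Iio_mem_nhds hc)).and (eventually_ge_atTop 1)).exists
  exact absurd (real_twoClusterEvt_add_ge hn k) (not_le.2 hlt)

/-- **No decay at bounded additive aspect**, spelled inline over tree declarations: for every fixed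
`k`, the crux statement with `⌈n^{7/6}⌉` replaced by `n + k` is false. [folklore] -/
theorem nearLinearTwoClusterDecay_false_additive_aspect (k : ℕ) :
    ¬ Tendsto (fun n : ℕ => (bondPercolation (zdGraph 3) (criticalProbI 3)).real
      {ω | ∃ x ∈ box 3 n, ∃ x' ∈ box 3 n, ∃ y ∈ innerBoundary (zdGraph 3) (box 3 (n + k)),
        ∃ y' ∈ innerBoundary (zdGraph 3) (box 3 (n + k)),
          ω ∈ openConnIn ↑(box 3 (n + k)) x y ∧ ω ∈ openConnIn ↑(box 3 (n + k)) x' y' ∧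
          ω ∉ openConnIn ↑(box 3 (n + k)) x x'}) atTop (𝓝 0) :=
  not_tendsto_additive_aspect k

end

end Summit.CriticalPhenomena.PercolationContinuityZ3.Theorems.NearLinearTwoClusterDecay.Negative
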